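import Mathlib
import Literature.Analysis.FluidPDE.PoincareBall
import Summits.NavierStokesRegularity.NavierStokesRegularity.Theorems.EulerZoomLiouvillePowerGaugeEulerLiouvilleLionsGate
import HarnessLib

/-!
# Tools for F3's first lemma (β) «fictitious forces are constant under the pressure gauge»
# (crux `EulerZoomLiouville.PowerGaugeEulerLiouville` = stmt-NavierStokesRegularity-19832; line `galilean-frames` of ns-idea-11, typed lemma
# `Sig.lemma_fictitiousForceConstant`; width seat ns-ezl-w1 g4)

* `exists_two_essential_balls` — a measurable `b : ℝ → ℝ³` which is NOT a.e. constant on a set `S` of positive measure takes values in two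
  SEPARATED balls `B(z₁, r)`, `B(z₂, r)` (`dist z₁ z₂ = 4r`) on subsets of `S` of positive measure (Lindelöf covering twice);
* `setLIntegral_cylinder_enorm_rpow_le_of_gaugeD` — the `D`-gauge `a^{2ρ} D(a) ≤ c` unpacked: `∫∫_{Q_a(0,0)} |p|^{3/2} ≤ c a^{2−2ρ}`;
* `exists_slice_le_of_setLIntegral_le` — Chebyshev in time: a time set `A ⊆ (−a², 0)` of positive measure contains a slice with
  `∫_{B_a} |p(τ)|^{3/2} ≤ (c a^{2−2ρ}) / |A|`;
(the convexity bound `‖x − y‖ₑ^{3/2} ≤ 2^{1/2}(‖x‖ₑ^{3/2} + ‖y‖ₑ^{3/2})` is the tree's `enorm_sub_rpow_threeHalves_le`).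

WHAT THIS IS NOT: not NS, not E — `--supports` stmt-19832; 19832 OPEN; NS regularity NOT proved. [folklore]
-/

noncomputable section

-- flat `Theorems/<Route><Decl>…` files of one crux share the namespace of the crux (tree convention)
set_option linter.dupNamespace false

open MeasureTheory Set Filter Topology Metric Function InnerProductSpace TopologicalSpace
open scoped RealInnerProductSpace NNReal ENNReal

namespace Summit.NavierStokesRegularity.NavierStokesRegularity.Theorems.PowerGaugeEulerLiouville.GalileanFrames

open Literature.Analysis Literature.Analysis.FluidPDE

/-- **Two essential values.**  If a measurable `b : ℝ → ℝ³` is not a.e. constant on a measurable set `S` of positive measure, there are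
two balls `B(z₁, r)`, `B(z₂, r)` with `dist z₁ z₂ = 4r > 0` (so any two points of them are `≥ 2r` apart) whose preimages meet `S` in
positive measure. [folklore] -/
theorem exists_two_essential_balls {b : ℝ → EuclideanSpace ℝ (Fin 3)} (hb : Measurable b) {S : Set ℝ}
    (hS0 : volume S ≠ 0) (hnc : ¬ ∃ b₀ : EuclideanSpace ℝ (Fin 3), ∀ᵐ τ ∂(volume.restrict S), b τ = b₀) :
    ∃ (z₁ z₂ : EuclideanSpace ℝ (Fin 3)) (r : ℝ), 0 < r ∧ dist z₂ z₁ = 4 * r ∧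
      volume (S ∩ b ⁻¹' ball z₁ r) ≠ 0 ∧ volume (S ∩ b ⁻¹' ball z₂ r) ≠ 0 := by
  set μ : Measure ℝ := volume.restrict S with hμ
  have hpre : ∀ (U : Set (EuclideanSpace ℝ (Fin 3))), MeasurableSet U → μ (b ⁻¹' U) = volume (S ∩ b ⁻¹' U) := by
    intro U hU
    rw [hμ, Measure.restrict_apply (hb hU), inter_comm]
  -- an essential value `z₁`: every ball about it has a preimage of positive measure
  obtain ⟨z₁, hz₁⟩ : ∃ z₁ : EuclideanSpace ℝ (Fin 3), ∀ r : ℝ, 0 < r → μ (b ⁻¹' ball z₁ r) ≠ 0 := by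
    by_contra h
    push Not at h
    choose r hr hr0 using h
    obtain ⟨T, hTc, hTU⟩ := TopologicalSpace.isOpen_iUnion_countable (fun z => ball z (r z)) fun z => isOpen_ball
    have hcov : (⋃ z ∈ T, ball z (r z)) = univ := by
      rw [hTU]; exact eq_univ_of_forall fun z => mem_iUnion.2 ⟨z, mem_ball_self (hr z)⟩
    have hnull : μ (b ⁻¹' ⋃ z ∈ T, ball z (r z)) = 0 := by
      rw [preimage_iUnion₂]
      exact (measure_biUnion_null_iff hTc).2 fun z _ => hr0 z
    rw [hcov, preimage_univ, hμ, Measure.restrict_apply_univ] at hnull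
    exact hS0 hnull
  -- `b` is not a.e. `z₁`: the complement `{z₁}ᶜ` has a preimage of positive measure, hence so does some ball away from `z₁`
  have hne : μ (b ⁻¹' {z₁}ᶜ) ≠ 0 := by
    intro h0
    apply hnc
    refine ⟨z₁, ?_⟩
    have : ∀ᵐ τ ∂μ, τ ∉ b ⁻¹' ({z₁}ᶜ : Set (EuclideanSpace ℝ (Fin 3))) := measure_eq_zero_iff_ae_notMem.1 h0
    filter_upwards [this] with τ hτ
    simpa using hτ
  set ρ' : EuclideanSpace ℝ (Fin 3) → ℝ := fun w => dist w z₁ / 4 with hρ'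
  obtain ⟨T, hTc, hTU⟩ := TopologicalSpace.isOpen_iUnion_countable (fun w => ball w (ρ' w)) fun w => isOpen_ball
  have hcov : (⋃ w ∈ T, ball w (ρ' w)) = ({z₁}ᶜ : Set (EuclideanSpace ℝ (Fin 3))) := by
    rw [hTU]
    ext y
    simp only [mem_iUnion, mem_ball, mem_compl_iff, mem_singleton_iff]
    constructor
    · rintro ⟨w, hw⟩ rfl
      rw [hρ'] at hw
      simp only at hw
      linarith [dist_nonneg (x := y) (y := w), dist_comm y w]
    · intro hy
      refine ⟨y, ?_⟩
      rw [hρ', dist_self]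
      simp only
      exact div_pos (dist_pos.2 hy) (by norm_num)
  obtain ⟨z₂, hz₂T, hz₂⟩ : ∃ w ∈ T, μ (b ⁻¹' ball w (ρ' w)) ≠ 0 := by
    by_contra h
    push Not at h
    apply hne
    rw [← hcov, preimage_iUnion₂]
    exact (measure_biUnion_null_iff hTc).2 h
  have hz₂ne : z₂ ≠ z₁ := by
    rintro rfl
    apply hz₂
    rw [hρ']
    simp only [dist_self, zero_div, ball_zero, preimage_empty, measure_empty]
  set r : ℝ := ρ' z₂ with hr
  have hr0 : 0 < r := div_pos (dist_pos.2 hz₂ne) (by norm_num)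
  refine ⟨z₁, z₂, r, hr0, by rw [hr, hρ']; ring, ?_, ?_⟩
  · rw [← hpre _ measurableSet_ball]; exact hz₁ r hr0
  · rw [← hpre _ measurableSet_ball]; exact hz₂

/-- **The `D`-gauge unpacked**: `a^{2ρ} D(a) ≤ c` gives `∫∫_{(−a²,0) × B_a} |p|^{3/2} ≤ c a^{2−2ρ}`. [folklore] -/
theorem setLIntegral_cylinder_enorm_rpow_le_of_gaugeD {ρ : ℝ} {p : ℝ → EuclideanSpace ℝ (Fin 3) → ℝ} {c : ℝ≥0}
    (hD : ∀ a : ℝ, 0 < a → ENNReal.ofReal (a ^ (2 * ρ)) * cknD a (0 : ℝ × EuclideanSpace ℝ (Fin 3)) p ≤ (c : ℝ≥0∞))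
    {a : ℝ} (ha : 0 < a) :
    ∫⁻ z in Ioo (-(a ^ 2)) 0 ×ˢ ball (0 : EuclideanSpace ℝ (Fin 3)) a, ‖p z.1 z.2‖ₑ ^ (3 / 2 : ℝ) ≤
      ENNReal.ofReal ((c : ℝ) * a ^ (2 - 2 * ρ)) := by
  have h := hD a ha
  unfold cknD at h
  rw [LionsGate.parabolicCylinder_zero'] at h
  set I := ∫⁻ z in Ioo (-(a ^ 2)) 0 ×ˢ ball (0 : EuclideanSpace ℝ (Fin 3)) a, ‖p z.1 z.2‖ₑ ^ (3 / 2 : ℝ) with hI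
  have hane : ENNReal.ofReal a ≠ 0 := (ENNReal.ofReal_pos.2 ha).ne'
  have ha2ne : ENNReal.ofReal a ^ 2 ≠ 0 := pow_ne_zero _ hane
  have ha2top : ENNReal.ofReal a ^ 2 ≠ ⊤ := ENNReal.pow_ne_top ENNReal.ofReal_ne_top
  have hρne : ENNReal.ofReal (a ^ (2 * ρ)) ≠ 0 := (ENNReal.ofReal_pos.2 (Real.rpow_pos_of_pos ha _)).ne'
  have hρtop : ENNReal.ofReal (a ^ (2 * ρ)) ≠ ⊤ := ENNReal.ofReal_ne_top
  -- `I = a² · a^{−2ρ} · (a^{2ρ} · a^{−2} · I) ≤ a² a^{−2ρ} c`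
  have e1 : I = ENNReal.ofReal a ^ 2 * (ENNReal.ofReal (a ^ (2 * ρ)))⁻¹ *
      (ENNReal.ofReal (a ^ (2 * ρ)) * ((ENNReal.ofReal a ^ 2)⁻¹ * I)) := by
    rw [show ENNReal.ofReal a ^ 2 * (ENNReal.ofReal (a ^ (2 * ρ)))⁻¹ *
        (ENNReal.ofReal (a ^ (2 * ρ)) * ((ENNReal.ofReal a ^ 2)⁻¹ * I)) =
        (ENNReal.ofReal a ^ 2 * (ENNReal.ofReal a ^ 2)⁻¹) *
          ((ENNReal.ofReal (a ^ (2 * ρ)))⁻¹ * ENNReal.ofReal (a ^ (2 * ρ))) * I by ring,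
      ENNReal.mul_inv_cancel ha2ne ha2top, ENNReal.inv_mul_cancel hρne hρtop, one_mul, one_mul]
  rw [e1]
  calc ENNReal.ofReal a ^ 2 * (ENNReal.ofReal (a ^ (2 * ρ)))⁻¹ *
        (ENNReal.ofReal (a ^ (2 * ρ)) * ((ENNReal.ofReal a ^ 2)⁻¹ * I))
      ≤ ENNReal.ofReal a ^ 2 * (ENNReal.ofReal (a ^ (2 * ρ)))⁻¹ * (c : ℝ≥0∞) := mul_le_mul' le_rfl h
    _ = ENNReal.ofReal ((c : ℝ) * a ^ (2 - 2 * ρ)) := by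
        rw [← ENNReal.ofReal_pow ha.le, ← ENNReal.ofReal_inv_of_pos (Real.rpow_pos_of_pos ha _),
          ← ENNReal.ofReal_mul (by positivity), ← ENNReal.ofReal_coe_nnreal, ← ENNReal.ofReal_mul (by positivity)]
        congr 1
        rw [Real.rpow_sub ha, show a ^ (2 : ℝ) = a ^ 2 by exact_mod_cast Real.rpow_natCast a 2]
        field_simp

/-- **Chebyshev in time**: if `A ⊆ (−a², 0)` is measurable with positive measure and the pressure is a.e.-strongly measurable on the
cylinder, some slice `τ ∈ A` has `∫_{B_a}|p(τ)|^{3/2} ≤ (∫∫_{(−a²,0)×B_a}|p|^{3/2}) / |A|`. [folklore] -/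
theorem exists_slice_le_div {p : ℝ → EuclideanSpace ℝ (Fin 3) → ℝ} {a : ℝ} {A : Set ℝ}
    (hA0 : volume A ≠ 0) (hAsub : A ⊆ Ioo (-(a ^ 2)) 0)
    (hpm : AEStronglyMeasurable (uncurry p) (volume.restrict (Ioo (-(a ^ 2)) 0 ×ˢ ball (0 : EuclideanSpace ℝ (Fin 3)) a))) :
    ∃ τ ∈ A, ∫⁻ y in ball (0 : EuclideanSpace ℝ (Fin 3)) a, ‖p τ y‖ₑ ^ (3 / 2 : ℝ) ≤
      (∫⁻ z in Ioo (-(a ^ 2)) 0 ×ˢ ball (0 : EuclideanSpace ℝ (Fin 3)) a, ‖p z.1 z.2‖ₑ ^ (3 / 2 : ℝ)) / volume A := by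
  have hAfin : volume A ≠ ⊤ :=
    (lt_of_le_of_lt (measure_mono hAsub) (by rw [Real.volume_Ioo]; exact ENNReal.ofReal_lt_top)).ne
  set g : ℝ × EuclideanSpace ℝ (Fin 3) → ℝ≥0∞ := fun z => ‖p z.1 z.2‖ₑ ^ (3 / 2 : ℝ) with hg
  have hμ : (volume : Measure (ℝ × EuclideanSpace ℝ (Fin 3))).restrict (A ×ˢ ball (0 : EuclideanSpace ℝ (Fin 3)) a) =
      ((volume : Measure ℝ).restrict A).prod
        ((volume : Measure (EuclideanSpace ℝ (Fin 3))).restrict (ball (0 : EuclideanSpace ℝ (Fin 3)) a)) := by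
    rw [Measure.prod_restrict, ← Measure.volume_eq_prod]
  have hgm : AEMeasurable g (((volume : Measure ℝ).restrict A).prod
      ((volume : Measure (EuclideanSpace ℝ (Fin 3))).restrict (ball (0 : EuclideanSpace ℝ (Fin 3)) a))) := by
    rw [← hμ]
    exact (hpm.mono_measure (Measure.restrict_mono (prod_mono hAsub subset_rfl) le_rfl)).enorm.pow_const _
  have hslice : AEMeasurable (fun τ => ∫⁻ y in ball (0 : EuclideanSpace ℝ (Fin 3)) a, ‖p τ y‖ₑ ^ (3 / 2 : ℝ))
      ((volume : Measure ℝ).restrict A) := hgm.lintegral_prod_right'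
  obtain ⟨τ, hτA, hτ⟩ := exists_le_setLAverage hA0 hAfin hslice
  refine ⟨τ, hτA, hτ.trans ?_⟩
  rw [laverage_eq, Measure.restrict_apply_univ]
  gcongr
  -- `∫_A ∫_{B_a} = ∫∫_{A × B_a} ≤ ∫∫_{(−a²,0) × B_a}`
  calc ∫⁻ τ in A, ∫⁻ y in ball (0 : EuclideanSpace ℝ (Fin 3)) a, ‖p τ y‖ₑ ^ (3 / 2 : ℝ)
      = ∫⁻ z in A ×ˢ ball (0 : EuclideanSpace ℝ (Fin 3)) a, g z := by
        rw [hμ, lintegral_prod _ hgm]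
    _ ≤ ∫⁻ z in Ioo (-(a ^ 2)) 0 ×ˢ ball (0 : EuclideanSpace ℝ (Fin 3)) a, g z :=
        lintegral_mono_set (prod_mono hAsub subset_rfl)

/-! ### Appended: window bookkeeping and slice transport for `…GalileanFictitiousForce` -/

/-- Removing a null set does not kill positive (outer) measure. [folklore] -/
theorem measure_inter_ne_zero_of_null_compl {X G : Set ℝ} (hX : volume X ≠ 0) (hG : volume Gᶜ = 0) :
    volume (X ∩ G) ≠ 0 := by
  intro h0
  apply hX
  refine le_antisymm ?_ bot_le
  calc volume X ≤ volume (X ∩ G ∪ Gᶜ) := measure_mono fun τ hτ => by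
          by_cases hG' : τ ∈ G
          · exact Or.inl ⟨hτ, hG'⟩
          · exact Or.inr hG'
    _ ≤ volume (X ∩ G) + volume Gᶜ := measure_union_le _ _
    _ = 0 := by rw [h0, hG, add_zero]

/-- A set of positive measure inside `(−∞, T₁)` meets some bounded window `(T₁ − (K+1), T₁ − 1/(K+1))` in positive measure. [folklore] -/
theorem exists_window_inter_ne_zero {X : Set ℝ} {T₁ : ℝ} (hX : volume X ≠ 0) (hXs : X ⊆ Iio T₁) :
    ∃ K : ℕ, volume (X ∩ Ioo (T₁ - ((K : ℝ) + 1)) (T₁ - 1 / ((K : ℝ) + 1))) ≠ 0 := by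
  by_contra h
  push Not at h
  apply hX
  have hcov : X ⊆ ⋃ K : ℕ, X ∩ Ioo (T₁ - ((K : ℝ) + 1)) (T₁ - 1 / ((K : ℝ) + 1)) := by
    intro τ hτ
    have hlt : 0 < T₁ - τ := sub_pos.2 (hXs hτ)
    obtain ⟨K, hK⟩ := exists_nat_gt (max (T₁ - τ) (1 / (T₁ - τ)))
    refine mem_iUnion.2 ⟨K, hτ, ?_, ?_⟩
    · have := (le_max_left _ _).trans_lt hK; linarith
    · have h1 : 1 / (T₁ - τ) < (K : ℝ) + 1 := by linarith [(le_max_right _ _).trans_lt hK]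
      have h2 : 1 / ((K : ℝ) + 1) < T₁ - τ := by
        rw [div_lt_iff₀ (by positivity)]
        rw [div_lt_iff₀ hlt] at h1
        linarith
      linarith
  exact le_antisymm ((measure_mono hcov).trans (by rw [measure_iUnion_null h])) bot_le

/-- **Slice transport.**  If `q(y) = m·(P̄(s(y−ξ₀)) − ⟪β, s(y−ξ₀)⟫ + c′)` with `m, s > 0` and `L/s + ‖ξ₀‖ ≤ a`, then
`∫_{B_L} |P̄ − ⟪β,·⟫ + c′|^{3/2} ≤ s³ m^{−3/2} ∫_{B_a} |q|^{3/2}` (substitution `Y = s(y − ξ₀)`, `B(ξ₀, L/s) ⊆ B_a`). [folklore] -/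
theorem setLIntegral_profile_le_of_slice {q : EuclideanSpace ℝ (Fin 3) → ℝ} {Pbar : EuclideanSpace ℝ (Fin 3) → ℝ}
    {β ξ₀ : EuclideanSpace ℝ (Fin 3)} {c' m s L a : ℝ} (hm : 0 < m) (hs : 0 < s) (hLs : L / s + ‖ξ₀‖ ≤ a)
    (hq : ∀ y, q y = m * (Pbar (s • (y - ξ₀)) - ⟪β, s • (y - ξ₀)⟫ + c')) :
    ∫⁻ Y in ball (0 : EuclideanSpace ℝ (Fin 3)) L, ‖Pbar Y - ⟪β, Y⟫ + c'‖ₑ ^ (3 / 2 : ℝ) ≤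
      ENNReal.ofReal (s ^ 3 * m ^ (-(3 / 2 : ℝ))) *
        ∫⁻ y in ball (0 : EuclideanSpace ℝ (Fin 3)) a, ‖q y‖ₑ ^ (3 / 2 : ℝ) := by
  set f : EuclideanSpace ℝ (Fin 3) → ℝ := fun Y => Pbar Y - ⟪β, Y⟫ + c' with hfdef
  have hqy : ∀ y, q y = m * f (s • y + (-(s • ξ₀))) := fun y => by
    rw [hq y, hfdef, smul_sub, sub_eq_add_neg (s • y)]
  have hsub : ∫⁻ y, (ball (0 : EuclideanSpace ℝ (Fin 3)) L).indicator (fun Y => ‖f Y‖ₑ ^ (3 / 2 : ℝ))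
      (s • y + (-(s • ξ₀))) = ENNReal.ofReal |(s ^ Module.finrank ℝ (EuclideanSpace ℝ (Fin 3)))⁻¹| *
        ∫⁻ Y in ball (0 : EuclideanSpace ℝ (Fin 3)) L, ‖f Y‖ₑ ^ (3 / 2 : ℝ) := by
    rw [PoincareBall.lintegral_comp_smul_add _ hs.ne', lintegral_indicator measurableSet_ball]
  rw [finrank_euclideanSpace_fin, abs_of_pos (inv_pos.2 (pow_pos hs 3))] at hsub
  have hLs' : L / s ≤ a - ‖ξ₀‖ := by linarith
  have hdom : ∀ y, ENNReal.ofReal (m ^ (3 / 2 : ℝ)) *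
      (ball (0 : EuclideanSpace ℝ (Fin 3)) L).indicator (fun Y => ‖f Y‖ₑ ^ (3 / 2 : ℝ)) (s • y + (-(s • ξ₀))) ≤
      (ball (0 : EuclideanSpace ℝ (Fin 3)) a).indicator (fun y => ‖q y‖ₑ ^ (3 / 2 : ℝ)) y := by
    intro y
    by_cases hy : s • y + (-(s • ξ₀)) ∈ ball (0 : EuclideanSpace ℝ (Fin 3)) L
    · have hya : y ∈ ball (0 : EuclideanSpace ℝ (Fin 3)) a := by
        rw [mem_ball_zero_iff] at hy ⊢
        have h1 : s • y + (-(s • ξ₀)) = s • (y - ξ₀) := by rw [smul_sub, sub_eq_add_neg]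
        rw [h1, norm_smul, Real.norm_of_nonneg hs.le] at hy
        have h2 : ‖y - ξ₀‖ < L / s := by rw [lt_div_iff₀ hs, mul_comm]; exact hy
        calc ‖y‖ = ‖(y - ξ₀) + ξ₀‖ := by rw [sub_add_cancel]
          _ ≤ ‖y - ξ₀‖ + ‖ξ₀‖ := norm_add_le _ _
          _ < L / s + ‖ξ₀‖ := by linarith
          _ ≤ a := hLs
      rw [indicator_of_mem hy, indicator_of_mem hya]
      show ENNReal.ofReal (m ^ (3 / 2 : ℝ)) * ‖f (s • y + (-(s • ξ₀)))‖ₑ ^ (3 / 2 : ℝ) ≤ ‖q y‖ₑ ^ (3 / 2 : ℝ)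
      rw [hqy y, enorm_mul, ENNReal.mul_rpow_of_nonneg _ _ (by norm_num : (0 : ℝ) ≤ 3 / 2),
        Real.enorm_eq_ofReal hm.le, ENNReal.ofReal_rpow_of_pos hm]
    · rw [indicator_of_notMem hy, mul_zero]
      exact bot_le
  have hint : ENNReal.ofReal (m ^ (3 / 2 : ℝ)) * (ENNReal.ofReal (s ^ 3)⁻¹ *
      ∫⁻ Y in ball (0 : EuclideanSpace ℝ (Fin 3)) L, ‖f Y‖ₑ ^ (3 / 2 : ℝ)) ≤
      ∫⁻ y in ball (0 : EuclideanSpace ℝ (Fin 3)) a, ‖q y‖ₑ ^ (3 / 2 : ℝ) := by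
    rw [← hsub, ← lintegral_const_mul' _ _ ENNReal.ofReal_ne_top, ← lintegral_indicator measurableSet_ball]
    exact lintegral_mono hdom
  have hinv : ENNReal.ofReal (s ^ 3 * m ^ (-(3 / 2 : ℝ))) *
      (ENNReal.ofReal (m ^ (3 / 2 : ℝ)) * ENNReal.ofReal (s ^ 3)⁻¹) = 1 := by
    rw [← ENNReal.ofReal_mul (by positivity), ← ENNReal.ofReal_mul (by positivity), ← ENNReal.ofReal_one]
    congr 1
    rw [Real.rpow_neg hm.le]
    have : m ^ (3 / 2 : ℝ) ≠ 0 := (Real.rpow_pos_of_pos hm _).ne'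
    field_simp
  calc ∫⁻ Y in ball (0 : EuclideanSpace ℝ (Fin 3)) L, ‖f Y‖ₑ ^ (3 / 2 : ℝ)
      = (ENNReal.ofReal (s ^ 3 * m ^ (-(3 / 2 : ℝ))) *
          (ENNReal.ofReal (m ^ (3 / 2 : ℝ)) * ENNReal.ofReal (s ^ 3)⁻¹)) *
          ∫⁻ Y in ball (0 : EuclideanSpace ℝ (Fin 3)) L, ‖f Y‖ₑ ^ (3 / 2 : ℝ) := by rw [hinv, one_mul]
    _ = ENNReal.ofReal (s ^ 3 * m ^ (-(3 / 2 : ℝ))) * (ENNReal.ofReal (m ^ (3 / 2 : ℝ)) *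
          (ENNReal.ofReal (s ^ 3)⁻¹ * ∫⁻ Y in ball (0 : EuclideanSpace ℝ (Fin 3)) L, ‖f Y‖ₑ ^ (3 / 2 : ℝ))) := by
        simp only [mul_assoc]
    _ ≤ _ := mul_le_mul' le_rfl hint

/-- **Slice measurability.**  With `q` as above and a.e.-strongly measurable, `Y ↦ |P̄(Y) − ⟪β,Y⟫ + c′|^{3/2}` is a.e.-measurable
(`P̄ − ⟪β,·⟫ + c′ = m⁻¹ q(ξ₀ + s⁻¹ ·)`, an affine change of variables). [folklore] -/
theorem aemeasurable_profile_of_slice {q : EuclideanSpace ℝ (Fin 3) → ℝ} {Pbar : EuclideanSpace ℝ (Fin 3) → ℝ}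
    {β ξ₀ : EuclideanSpace ℝ (Fin 3)} {c' m s : ℝ} (hm : 0 < m) (hs : 0 < s) (hqm : AEStronglyMeasurable q volume)
    (hq : ∀ y, q y = m * (Pbar (s • (y - ξ₀)) - ⟪β, s • (y - ξ₀)⟫ + c')) :
    AEMeasurable (fun Y => ‖Pbar Y - ⟪β, Y⟫ + c'‖ₑ ^ (3 / 2 : ℝ)) volume := by
  have hfY : ∀ Y, Pbar Y - ⟪β, Y⟫ + c' = m⁻¹ * q (ξ₀ + s⁻¹ • Y) := by
    intro Y
    rw [hq, add_sub_cancel_left, smul_smul, mul_inv_cancel₀ hs.ne', one_smul, ← mul_assoc,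
      inv_mul_cancel₀ hm.ne', one_mul]
  have hqmp : Measure.QuasiMeasurePreserving
      (fun Y : EuclideanSpace ℝ (Fin 3) => ξ₀ + s⁻¹ • Y) volume volume := by
    have h1 : Measure.QuasiMeasurePreserving (fun Y : EuclideanSpace ℝ (Fin 3) => s⁻¹ • Y) volume volume := by
      refine ⟨measurable_const_smul _, ?_⟩
      rw [Measure.map_addHaar_smul volume (inv_ne_zero hs.ne')]
      exact Measure.smul_absolutelyContinuous
    exact (measurePreserving_add_left volume ξ₀).quasiMeasurePreserving.comp h1
  have hfm : AEStronglyMeasurable (fun Y => Pbar Y - ⟪β, Y⟫ + c') volume := by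
    have : (fun Y => Pbar Y - ⟪β, Y⟫ + c') = fun Y => m⁻¹ * (q ∘ fun Y => ξ₀ + s⁻¹ • Y) Y := by
      funext Y; exact hfY Y
    rw [this]
    exact (hqm.comp_quasiMeasurePreserving hqmp).const_mul _
  exact hfm.enorm.pow_const _

end Summit.NavierStokesRegularity.NavierStokesRegularity.Theorems.PowerGaugeEulerLiouville.GalileanFrames

end
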